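import Literature.MeasureTheory.Group.QuotientOrbitalIntegralProperContinuity   -- ★ (W1-cont-Π) FILE 1: (HYP) «uniformly proper mod M» ⇒ `ContinuousOn`; `uniformlyProper_pi` ∕ `_map_mulEquiv` ∕ `_of_forall_exists_isCompact` ∕ `_of_compactSpace`
import Literature.NumberTheory.Rogawski1990.ArchHyperbolicOrbitProperThree        -- ★ p849474 LH3-p03 (g2): (L2) `exists_isCompact_forall_hsOrbit_subset_of_diag_hyperbolic` (split Cartan of `U(Φ₃)(ℂ)`, HS-ball form)
import Literature.NumberTheory.Automorphic.ArchLocalTorusOrbitalContinuity         -- ★ `isCompact_setOf_exists_conj_circleDiagonal_mem` (compact Cartan of `U(σ_w diag α)(ℂ)`, any signature)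
import Literature.NumberTheory.Automorphic.UnitaryGroupArchimedeanPlaces           -- ★ `archLocal`, `archPiEquivCM : U(H)(L⁺ ⊗ ℝ) ≃ₜ* Π_w U(σ_w H)(ℂ)`, `isCompact_archLocal_of_posDef`
import Literature.MeasureTheory.Group.InvariantQuotientOrbitalProd                 -- ★ `mulEquiv_apply_mem_centralizer_singleton_iff` (`e(Z(γ)) = Z(e γ)`)
import HarnessLib

/-!
# Ordinary orbital integrals on `G′_∞ = U(H′)(L⁺ ⊗ ℝ)` are continuous on the regular set of a product Cartan — the per-place inputs and the places assembly
(Rogawski (1990) §4.3 p. 43, §8.3 p. 122; Shelstad (1979) §4; Beuzart-Plessis (2020) §1.2, §1.8; Deitmar–Echterhoff (2014) Lemma 9.3.3; Folland (1995) Thm. 2.49)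

Topic `NumberTheory/Rogawski1990`; namespace `Literature.NumberTheory.Rogawski1990`.  THEOREMS ONLY (no `def`, no instance, no notation, no axiom, no named fact, no
`sorry`).  Cell `pub/hodgecm-mathlib`, crux H413 (`stmt-HodgeConjecture-24833`), line LH3 (closer stub `stub_N9`, DIRECT ROAD, clause (M1) ∕ O-READ input
«`a′ ∈ C_c(G′_∞)` has ordinary orbital integrals `ContinuousOn` the regular set of every Cartan `T_{S′}` in fixed-`tT` currency»); organ «(W1-cont-Π)» FILE 2 =
the `U(2,1)^d` DRESS of ★ `QuotientOrbitalIntegralProperContinuity` (FILE 1), dealt by LH3-plan (g2) 2026-09-02T05:31:39Z (notes (n1)(n2)) to LH2-p04 (g3).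
Count-neutral (VOL)∕(CONV) kit.

THE MATHEMATICS.  `G′_∞ = U(H′)(L⁺ ⊗ ℝ) ≅ Π_w G′_w`, `G′_w = U(σ_w H′)(ℂ)` over the complex places `w` of the CM field `L` (★ `archPiEquivCM`, a `≃ₜ*`).  A Cartan
subgroup `T_{S′} ≤ G′_∞` is a product `Π_w T_w`; FILE 1 reduces «the quotient orbital integral `x ↦ ∫_{G′_∞ ⧸ T_{S′}} a′(y γ′(x) y⁻¹) dμ′` is continuous on the
product of the per-place regular sets» to the hypothesis (HYP) «uniformly proper modulo `T_w`» AT EACH PLACE (`uniformlyProper_pi` + `uniformlyProper_map_mulEquiv`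
+ `continuousOn_integral_descConj_of_uniformlyProper`).  This file supplies (HYP) per place, in the tree's carriers, and the assembled statement:
* §1 SPLIT PLACE (`G′_w ≅ U(2,1)`, `T_w` the SPLIT Cartan): on the model `U = U(Φ₃)(ℂ)`, `T = Z(γ₁)`, `γ₁ = diag(α₁, u₁, ᾱ₁⁻¹)` regular, ★ (L2)
  `exists_isCompact_forall_hsOrbit_subset_of_diag_hyperbolic` (orbit HS-balls uniformly bounded mod `T` over compacta of `T_reg`) IS (HYP) after «a compact
  `C ⊆ U` lies in an HS-ball» — **`uniformlyProper_centralizer_of_diag_hyperbolic`**; transported along ANY bicontinuous frame `e : U ≃* G′_w` with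
  `T_w := Z(e γ₁) = e(Z(γ₁))` — **`uniformlyProper_centralizer_map_of_diag_hyperbolic`** (the (T-ATLAS) split chart at `w ∈ S′` factors through such an `e`).
* §2 COMPACT CARTAN AT ANY PLACE (`T_w ⊇` the diagonal circle torus of `U(σ_w diag α)(ℂ)`, any signature): ★ `isCompact_setOf_exists_conj_circleDiagonal_mem`
  (the conjugating set itself is compact in `G′_w` over compacta of the regular set `{z ∣ z injective}`) ⇒ (HYP) for EVERY subgroup `M` —
  **`uniformlyProper_circleDiagonal`**.
* §3 DEFINITE PLACE (`G′_w = U(3)` compact, ★ `isCompact_archLocal_of_posDef`): (HYP) for every chart and every `M` — **`uniformlyProper_archLocal_of_definite`**.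
* §4 THE PLACES ASSEMBLY on `G′_∞` (note (n1): over an ABSTRACT continuous chart `c_w : X_w → G′_w` per place commuting with `M_w`, and any `M′ ≤ G′_∞` with
  `archPiEquivCM⁻¹ (g_w)_w ∈ M′ ↔ ∀ w, g_w ∈ M_w`): **`continuousOn_integral_descConj_arch_of_uniformlyProper_places`** — for `a′ ∈ C_c(G′_∞, E)` and ANY measure
  `μ′` on `G′_∞ ⧸ M′` finite on compact sets (note (n2)), `x ↦ ∫_{G′_∞ ⧸ M′} a′(y · archPiEquivCM⁻¹((c_w(x_w))_w) · y⁻¹) dμ′(ȳ)` is `ContinuousOn (Set.pi univ S)`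
  whenever every place is uniformly proper on `S_w` (§1∕§2∕§3 by the type of `w`).
NOT HERE (ED. 2, ≈20 lines, when LH3-p03's (T-ATLAS) PART 2 `gprimeTorus S′ c` is ★): the docking `c_w :=` the atlas chart at `w`, `M′ := T_{S′}`, `S_w :=` the
atlas regular set (`InRegG`), which is one `uniformlyProper_comp` per place over §1–§3.  The `m′`-currency reading (`classOrbitalIntegral m′ a′ ⟦·⟧`, `hnorm`) stays
(CUR)∕L4's.  HONEST LABEL: HC_CM is proved only modulo the 7 printed citations (2 remaining: hLiu418 = `stmt-HodgeConjecture-24832`, h413 = `stmt-HodgeConjecture-24833`)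
until rung 0 closes; this file pays no organ of the closer and moves no row of the books.

## References
* [Rogawski1990] J. D. Rogawski, *Automorphic Representations of Unitary Groups in Three Variables*, Ann. of Math. Stud. 123 (1990), §4.3 p. 43 (`G_∞ = Π_w G_w`,
  compact at definite places), §3.6 p. 31 (Cartan subgroups of `U(2,1)`), §8.3 p. 122 (orbital integrals as functions on `T_reg`).
* [Shelstad1979] D. Shelstad, *Characters and inner forms of a quasi-split group over ℝ*, Compositio Math. 39 (1979), §4.
* [BeuzartPlessis2020Asterisque] R. Beuzart-Plessis, Astérisque 418 (2020), §1.2 (1.2.2), (1.2.4) p. 21; §1.8 p. 39 (orbit vs group balls; regular semisimple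
  orbital integrals).
* [DeitmarEchterhoff2014] A. Deitmar, S. Echterhoff, *Principles of Harmonic Analysis*, 2nd ed. (2014), Lemma 9.3.3.
* [Folland1995] G. B. Folland, *A Course in Abstract Harmonic Analysis* (1995), §2.6 Thm. 2.49.
* [PlatonovRapinchuk1994] V. Platonov, A. Rapinchuk, *Algebraic Groups and Number Theory* (1994), §3.2 Thm. 3.1 (anisotropic at `∞` ⇔ compact).
-/

set_option autoImplicit false

noncomputable section

open MeasureTheory MeasureTheory.Measure Set Topology NumberField NumberField.InfinitePlace
open Literature.MeasureTheory.Group Literature.NumberTheory.Automorphic Literature.NumberTheory.Automorphic.UnitaryGroup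
open scoped MatrixGroups Matrix ComplexOrder

namespace Literature.NumberTheory.Rogawski1990

/-! ## §1 Split place: the split Cartan of `U(2,1)` is uniformly proper on its regular set (★ L2 in (HYP) form), and so is every frame-transport -/

section Split

variable {γ₁ : ↥(unitaryGroupOfForm (starRingEnd ℂ) (Matrix.of fun i j : Fin 3 => if i.val + j.val + 1 = 3 then (1 : ℂ) else 0))} {α₁ u₁ : ℂ}
  (hγ₁ : ((γ₁ : GL (Fin 3) ℂ) : Matrix (Fin 3) (Fin 3) ℂ) = !![α₁, 0, 0; 0, u₁, 0; 0, 0, (star α₁)⁻¹]) (hu₁ : ‖u₁‖ = 1) (hα₁1 : ‖α₁‖ ≠ 1)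

include hγ₁ hu₁ hα₁1 in
/-- **THE SPLIT CARTAN OF `U(2,1)` IS UNIFORMLY PROPER ON ITS REGULAR SET** — ★ (L2) `exists_isCompact_forall_hsOrbit_subset_of_diag_hyperbolic` in the (HYP) form of
★ `continuousOn_integral_descConj_of_uniformlyProper`: for compact `K ⊆ T_reg = {t ∈ Z(γ₁) ∣ |t₀₀| ≠ 1}` and compact `C ⊆ U(Φ₃)(ℂ)` there is a compact `𝒦 ⊆ U ⧸ Z(γ₁)`
containing `y Z(γ₁)` whenever `y t y⁻¹ ∈ C` for some `t ∈ K` (a compact `C` lies in an HS-ball `{Σ|g_ij|² ≤ R}`).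
[cite: BeuzartPlessis2020Asterisque, §1.2 (1.2.2), (1.2.4) p. 21; §1.8 p. 39] [cite: Rogawski1990, §8.3 p. 122] [cite: DeitmarEchterhoff2014, Lemma 9.3.3] -/
theorem uniformlyProper_centralizer_of_diag_hyperbolic :
    ∀ K ⊆ {t : ↥(Subgroup.centralizer ({γ₁} : Set ↥(unitaryGroupOfForm (starRingEnd ℂ) (Matrix.of fun i j : Fin 3 => if i.val + j.val + 1 = 3 then (1 : ℂ) else 0)))) |
        ‖((((t : ↥(Subgroup.centralizer ({γ₁} : Set _))) :
          ↥(unitaryGroupOfForm (starRingEnd ℂ) (Matrix.of fun i j : Fin 3 => if i.val + j.val + 1 = 3 then (1 : ℂ) else 0))) : GL (Fin 3) ℂ) : Matrix (Fin 3) (Fin 3) ℂ) 0 0‖ ≠ 1},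
      IsCompact K → ∀ C : Set ↥(unitaryGroupOfForm (starRingEnd ℂ) (Matrix.of fun i j : Fin 3 => if i.val + j.val + 1 = 3 then (1 : ℂ) else 0)), IsCompact C →
        ∃ 𝒦 : Set (↥(unitaryGroupOfForm (starRingEnd ℂ) (Matrix.of fun i j : Fin 3 => if i.val + j.val + 1 = 3 then (1 : ℂ) else 0)) ⧸
            Subgroup.centralizer ({γ₁} : Set ↥(unitaryGroupOfForm (starRingEnd ℂ) (Matrix.of fun i j : Fin 3 => if i.val + j.val + 1 = 3 then (1 : ℂ) else 0)))),
          IsCompact 𝒦 ∧ ∀ t ∈ K, ∀ y : ↥(unitaryGroupOfForm (starRingEnd ℂ) (Matrix.of fun i j : Fin 3 => if i.val + j.val + 1 = 3 then (1 : ℂ) else 0)),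
            y * (t : ↥(unitaryGroupOfForm (starRingEnd ℂ) (Matrix.of fun i j : Fin 3 => if i.val + j.val + 1 = 3 then (1 : ℂ) else 0))) * y⁻¹ ∈ C →
              (QuotientGroup.mk y : ↥(unitaryGroupOfForm (starRingEnd ℂ) (Matrix.of fun i j : Fin 3 => if i.val + j.val + 1 = 3 then (1 : ℂ) else 0)) ⧸
                Subgroup.centralizer ({γ₁} : Set _)) ∈ 𝒦 := by
  intro K hKS hK C hC
  -- a compact set lies in an HS-ball
  have hHS : Continuous fun v : ↥(unitaryGroupOfForm (starRingEnd ℂ) (Matrix.of fun i j : Fin 3 => if i.val + j.val + 1 = 3 then (1 : ℂ) else 0)) =>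
      ∑ i : Fin 3, ∑ j : Fin 3, ‖((v : GL (Fin 3) ℂ) : Matrix (Fin 3) (Fin 3) ℂ) i j‖ ^ 2 := by
    have hA : Continuous fun v : ↥(unitaryGroupOfForm (starRingEnd ℂ) (Matrix.of fun i j : Fin 3 => if i.val + j.val + 1 = 3 then (1 : ℂ) else 0)) =>
        ((v : GL (Fin 3) ℂ) : Matrix (Fin 3) (Fin 3) ℂ) := Units.continuous_val.comp continuous_subtype_val
    refine continuous_finsetSum _ fun i _ => continuous_finsetSum _ fun j _ => ?_
    exact (continuous_norm.comp (hA.matrix_elem i j)).pow 2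
  obtain ⟨R₀, hR₀⟩ := hC.exists_bound_of_continuousOn hHS.continuousOn
  obtain ⟨𝒦, h𝒦, hmem⟩ := exists_isCompact_forall_hsOrbit_subset_of_diag_hyperbolic hγ₁ hu₁ hα₁1 hK (fun t ht => hKS ht) R₀
  refine ⟨𝒦, h𝒦, fun t ht y hy => hmem t ht y ?_⟩
  have h' := hR₀ _ hy
  rwa [Real.norm_of_nonneg (by positivity)] at h'

include hγ₁ hu₁ hα₁1 in
/-- **THE SAME THROUGH ANY FRAME** `e : U(Φ₃)(ℂ) ≃* G′_w` (bicontinuous; e.g. a Sylvester ∕ diagonal frame onto `U(σ_w H′)(ℂ)` at an indefinite place): the chart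
`t ↦ e(t)` of the transported split Cartan `Z(e γ₁) = e(Z(γ₁))` is uniformly proper modulo `Z(e γ₁)` on `T_reg` (★ `uniformlyProper_map_mulEquiv` over
★ `mulEquiv_apply_mem_centralizer_singleton_iff`).  The (HYP) binder of ★ `continuousOn_integral_descConj_mulEquiv_pi_of_uniformlyProper` at a split place.
[cite: Rogawski1990, §3.6 p. 31; §8.3 p. 122] [cite: BeuzartPlessis2020Asterisque, §1.8 p. 39] [cite: Folland1995, §2.6 Thm. 2.49] -/
theorem uniformlyProper_centralizer_map_of_diag_hyperbolic {G' : Type*} [Group G'] [TopologicalSpace G']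
    (e : ↥(unitaryGroupOfForm (starRingEnd ℂ) (Matrix.of fun i j : Fin 3 => if i.val + j.val + 1 = 3 then (1 : ℂ) else 0)) ≃* G')
    (he : Continuous e) (hes : Continuous e.symm) :
    ∀ K ⊆ {t : ↥(Subgroup.centralizer ({γ₁} : Set ↥(unitaryGroupOfForm (starRingEnd ℂ) (Matrix.of fun i j : Fin 3 => if i.val + j.val + 1 = 3 then (1 : ℂ) else 0)))) |
        ‖((((t : ↥(Subgroup.centralizer ({γ₁} : Set _))) :
          ↥(unitaryGroupOfForm (starRingEnd ℂ) (Matrix.of fun i j : Fin 3 => if i.val + j.val + 1 = 3 then (1 : ℂ) else 0))) : GL (Fin 3) ℂ) : Matrix (Fin 3) (Fin 3) ℂ) 0 0‖ ≠ 1},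
      IsCompact K → ∀ C' : Set G', IsCompact C' →
        ∃ 𝒦' : Set (G' ⧸ Subgroup.centralizer ({e γ₁} : Set G')), IsCompact 𝒦' ∧
          ∀ t ∈ K, ∀ y' : G',
            y' * e (t : ↥(unitaryGroupOfForm (starRingEnd ℂ) (Matrix.of fun i j : Fin 3 => if i.val + j.val + 1 = 3 then (1 : ℂ) else 0))) * y'⁻¹ ∈ C' →
              (QuotientGroup.mk y' : G' ⧸ Subgroup.centralizer ({e γ₁} : Set G')) ∈ 𝒦' :=
  uniformlyProper_map_mulEquiv e he hes (Subgroup.centralizer ({γ₁} : Set _)) (Subgroup.centralizer ({e γ₁} : Set G'))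
    (fun g => mulEquiv_apply_mem_centralizer_singleton_iff e γ₁ g)
    (fun t : ↥(Subgroup.centralizer ({γ₁} : Set ↥(unitaryGroupOfForm (starRingEnd ℂ) (Matrix.of fun i j : Fin 3 => if i.val + j.val + 1 = 3 then (1 : ℂ) else 0)))) =>
      (t : ↥(unitaryGroupOfForm (starRingEnd ℂ) (Matrix.of fun i j : Fin 3 => if i.val + j.val + 1 = 3 then (1 : ℂ) else 0))))
    (uniformlyProper_centralizer_of_diag_hyperbolic hγ₁ hu₁ hα₁1)

end Split

/-! ## §2 Compact Cartan at any place: the conjugating set is compact in `G′_w` itself -/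

section CompactCartan

variable (L : Type) [Field L] (N : ℕ) (α : Fin N → L) (w : {w : InfinitePlace L // IsComplex w})

/-- **THE DIAGONAL CIRCLE TORUS OF `U(σ_w diag α)(ℂ)` IS UNIFORMLY PROPER ON ITS REGULAR SET, FOR EVERY SUBGROUP `M`** (any signature of `diag α`): over a
compact set `K` of regular (= injective) angle tuples and a compact `C ⊆ G′_w`, the set of `g` with `g · diag(z) · g⁻¹ ∈ C` for some `z ∈ K` is compact in
`G′_w` itself (★ `isCompact_setOf_exists_conj_circleDiagonal_mem`, Harish-Chandra), hence its image in ANY `G′_w ⧸ M` is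
(★ `uniformlyProper_of_forall_exists_isCompact`).  The (HYP) binder at a place whose chart is the compact Cartan.
[cite: Rogawski1990, §8.3 p. 122; §3.6 p. 31] [cite: DeitmarEchterhoff2014, Lemma 9.3.3] [cite: Shelstad1979, §4] -/
theorem uniformlyProper_circleDiagonal (hα : ∀ i, α i ≠ 0) (M : Subgroup ↥(archLocal L N (Matrix.diagonal α) w)) :
    ∀ K ⊆ {z : Fin N → Circle | Function.Injective z}, IsCompact K → ∀ C : Set ↥(archLocal L N (Matrix.diagonal α) w), IsCompact C →
      ∃ 𝒦 : Set (↥(archLocal L N (Matrix.diagonal α) w) ⧸ M), IsCompact 𝒦 ∧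
        ∀ z ∈ K, ∀ y : ↥(archLocal L N (Matrix.diagonal α) w),
          y * (⟨circleDiagonal N z, circleDiagonal_mem_archLocal_diagonal L N α w z⟩ : ↥(archLocal L N (Matrix.diagonal α) w)) * y⁻¹ ∈ C →
            (QuotientGroup.mk y : ↥(archLocal L N (Matrix.diagonal α) w) ⧸ M) ∈ 𝒦 :=
  uniformlyProper_of_forall_exists_isCompact M
    (fun z : Fin N → Circle => (⟨circleDiagonal N z, circleDiagonal_mem_archLocal_diagonal L N α w z⟩ : ↥(archLocal L N (Matrix.diagonal α) w)))
    {z : Fin N → Circle | Function.Injective z}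
    fun K hKS hK C hC =>
      ⟨{g : ↥(archLocal L N (Matrix.diagonal α) w) | ∃ z ∈ K,
          g * (⟨circleDiagonal N z, circleDiagonal_mem_archLocal_diagonal L N α w z⟩ : ↥(archLocal L N (Matrix.diagonal α) w)) * g⁻¹ ∈ C},
        isCompact_setOf_exists_conj_circleDiagonal_mem L N α w hα hK hKS hC, fun z hz _ hy => ⟨z, hz, hy⟩⟩

end CompactCartan

/-! ## §3 Definite place: `G′_w` compact -/

section Definite

variable (L : Type) [Field L] (N : ℕ) (J : Matrix (Fin N) (Fin N) L) (w : {w : InfinitePlace L // IsComplex w})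

/-- **AT A DEFINITE PLACE EVERY CHART IS UNIFORMLY PROPER** (`σ_w J` positive or negative definite ⇒ `U(σ_w J)(ℂ)` compact, ★ `isCompact_archLocal_of_posDef`;
then `𝒦 := univ`, ★ `uniformlyProper_of_compactSpace`). [cite: Rogawski1990, §4.3 p. 43] [cite: PlatonovRapinchuk1994, §3.2 Thm. 3.1] -/
theorem uniformlyProper_archLocal_of_definite (hdef : (J.map w.1.embedding).PosDef ∨ (-J.map w.1.embedding).PosDef)
    {X : Type*} [TopologicalSpace X] (M : Subgroup ↥(archLocal L N J w)) (c : X → ↥(archLocal L N J w)) (S : Set X) :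
    ∀ K ⊆ S, IsCompact K → ∀ C : Set ↥(archLocal L N J w), IsCompact C →
      ∃ 𝒦 : Set (↥(archLocal L N J w) ⧸ M), IsCompact 𝒦 ∧
        ∀ x ∈ K, ∀ y : ↥(archLocal L N J w), y * c x * y⁻¹ ∈ C → (QuotientGroup.mk y : ↥(archLocal L N J w) ⧸ M) ∈ 𝒦 :=
  haveI : CompactSpace ↥(archLocal L N J w) := isCompact_iff_compactSpace.mp (isCompact_archLocal_of_posDef L N J w hdef)
  uniformlyProper_of_compactSpace M c S

end Definite

/-! ## §4 The places assembly on `G′_∞ = U(H′)(L⁺ ⊗ ℝ) ≅ Π_w U(σ_w H′)(ℂ)` -/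

section Assembly

variable (L : Type) [Field L] [NumberField L] [IsCMField L] (N : ℕ) (H : Matrix (Fin N) (Fin N) L)
  {E : Type*} [NormedAddCommGroup E] [NormedSpace ℝ E]

/-- Commutation on `G′_∞` from commutation per place: if `c_w(x_w)` commutes with `M_w` for every complex place `w` and `M′ ≤ G′_∞` corresponds to `Π_w M_w`
under ★ `archPiEquivCM`, then `archPiEquivCM⁻¹ (c_w(x_w))_w` commutes with `M′`. [cite: Rogawski1990, §4.3 p. 43] [cite: Folland1995, §2.6 Thm. 2.49] -/
theorem forall_mem_mul_comm_archPiEquivCM_symm {X : {w : InfinitePlace L // IsComplex w} → Type*}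
    (M : ∀ w, Subgroup ↥(archLocal L N H w)) (M' : Subgroup ↥(arch (↥(maximalRealSubfield L)) L (IsCMField.complexConj L) N H))
    (hMM' : ∀ g, (archPiEquivCM N L H).symm g ∈ M' ↔ g ∈ Subgroup.pi Set.univ M)
    (c : ∀ w, X w → ↥(archLocal L N H w)) (hcomm : ∀ w, ∀ x, ∀ m ∈ M w, m * c w x = c w x * m) (x : ∀ w, X w) :
    ∀ m' ∈ M', m' * (archPiEquivCM N L H).symm (fun w => c w (x w)) = (archPiEquivCM N L H).symm (fun w => c w (x w)) * m' :=
  forall_mem_mul_comm_map_of_forall_mem_iff (archPiEquivCM N L H).symm.toMulEquiv (Subgroup.pi Set.univ M) M' hMM'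
    (forall_mem_pi_mul_comm M c hcomm) x

/-- **ORDINARY ORBITAL INTEGRALS ON `G′_∞` ARE CONTINUOUS ON THE PRODUCT OF THE PER-PLACE REGULAR SETS.**  Let `c_w : X_w → G′_w = U(σ_w H′)(ℂ)` be continuous
charts (one per complex place `w`; `X_w` locally compact) of elements commuting with subgroups `M_w ≤ G′_w`, `S_w ⊆ X_w` open, each place UNIFORMLY PROPER modulo
`M_w` on `S_w` (§1 at split places, §2 at compact-Cartan places, §3 at definite places), and `M′ ≤ G′_∞ = U(H′)(L⁺ ⊗ ℝ)` the subgroup corresponding to `Π_w M_w`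
under ★ `archPiEquivCM` (`hMM′`; e.g. `M′ = T_{S′}`).  Then for every `a′ ∈ C_c(G′_∞, E)` and EVERY measure `μ′` on `G′_∞ ⧸ M′` finite on compact sets (e.g. the
Weil quotient `dν′ ∕ dt_T`), the quotient orbital integral `x ↦ ∫_{G′_∞ ⧸ M′} a′(y · archPiEquivCM⁻¹((c_w(x_w))_w) · y⁻¹) dμ′(ȳ)` is continuous on `Set.pi univ S`
(★ `continuousOn_integral_descConj_mulEquiv_pi_of_uniformlyProper` with `e := archPiEquivCM⁻¹`).  Clause (M1) ∕ the O-READ input of the direct road in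
fixed-`tT` currency. [cite: Rogawski1990, §8.3 p. 122; §4.3 p. 43] [cite: Shelstad1979, §4] [cite: DeitmarEchterhoff2014, Lemma 9.3.3] [cite: Folland1995, §2.6 Thm. 2.49] -/
theorem continuousOn_integral_descConj_arch_of_uniformlyProper_places
    {X : {w : InfinitePlace L // IsComplex w} → Type*} [∀ w, TopologicalSpace (X w)] [∀ w, LocallyCompactSpace (X w)]
    (M : ∀ w, Subgroup ↥(archLocal L N H w)) (M' : Subgroup ↥(arch (↥(maximalRealSubfield L)) L (IsCMField.complexConj L) N H))
    (hMM' : ∀ g, (archPiEquivCM N L H).symm g ∈ M' ↔ g ∈ Subgroup.pi Set.univ M)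
    {c : ∀ w, X w → ↥(archLocal L N H w)} (hc : ∀ w, Continuous (c w)) (hcomm : ∀ w, ∀ x, ∀ m ∈ M w, m * c w x = c w x * m)
    {S : ∀ w, Set (X w)} (hS : ∀ w, IsOpen (S w))
    (hprop : ∀ w, ∀ K ⊆ S w, IsCompact K → ∀ C : Set ↥(archLocal L N H w), IsCompact C →
      ∃ 𝒦 : Set (↥(archLocal L N H w) ⧸ M w), IsCompact 𝒦 ∧
        ∀ x ∈ K, ∀ y : ↥(archLocal L N H w), y * c w x * y⁻¹ ∈ C → (QuotientGroup.mk y : ↥(archLocal L N H w) ⧸ M w) ∈ 𝒦)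
    [MeasurableSpace (↥(arch (↥(maximalRealSubfield L)) L (IsCMField.complexConj L) N H) ⧸ M')]
    [OpensMeasurableSpace (↥(arch (↥(maximalRealSubfield L)) L (IsCMField.complexConj L) N H) ⧸ M')]
    (μ' : Measure (↥(arch (↥(maximalRealSubfield L)) L (IsCMField.complexConj L) N H) ⧸ M')) [IsFiniteMeasureOnCompacts μ']
    {a' : ↥(arch (↥(maximalRealSubfield L)) L (IsCMField.complexConj L) N H) → E} (ha' : Continuous a') (hac' : HasCompactSupport a') :
    ContinuousOn (fun x : ∀ w, X w =>
      ∫ q, descConj ((archPiEquivCM N L H).symm (fun w => c w (x w))) M'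
        (forall_mem_mul_comm_archPiEquivCM_symm L N H M M' hMM' c hcomm x) a' q ∂μ') (Set.pi Set.univ S) :=
  continuousOn_integral_descConj_mulEquiv_pi_of_uniformlyProper (archPiEquivCM N L H).symm.toMulEquiv
    (archPiEquivCM N L H).symm.continuous (archPiEquivCM N L H).continuous M M' hMM' hc hcomm hS hprop μ' ha' hac'

end Assembly

end Literature.NumberTheory.Rogawski1990

end
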